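import Literature.NumberTheory.LFunctions.NicolasMellin
import Literature.NumberTheory.LFunctions.RiemannXiProofs
import Literature.NumberTheory.LFunctions.RobinCriterion
import Literature.NumberTheory.LFunctions.NicolasMertensRH
import Mathlib.Analysis.Calculus.Deriv.Slope
import HarnessLib

/-!
# Nicolas's `Ω`-theorem and Robin's oscillation theorem (Robin 1984, §4 Prop. 1):
# discharge of `Robin1984_sigma_oscillation`

Topic: `Literature/NumberTheory/LFunctions`. Third and final step of the discharge of the named
fact `Literature.NumberTheory.LFunctions.Robin1984_sigma_oscillation` (`LagariasCriterion.lean`; Lagarias 2002, Prop. 3.2 =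
Robin 1984, §4 Prop. 1): if the Riemann hypothesis is false, there are `0 < β < 1/2` and `C > 0`
with `σ(n) ≥ e^γ n log log n + C n log log n/(log n)^β` for infinitely many `n`. It continues
`LandauOscillation.lean` (Landau's theorem), `PrimeLogSeries.lean` (the Dirichlet series) and
`NicolasMellin.lean` (the comparison function `g` and its Mellin transform), by the method of
Nicolas (1983, §4: proof of Thm. 3 (c), Prop. 3). Everything is proved (no named facts).

## Part I. Nicolas's `Ω`-theorem: if RH fails, `A(x) - γ - log log x - E(x) = Ω±(x^{-b})`

* `exists_nicolasFn_neg`: if the Riemann hypothesis is false, there is `b ∈ (0, 1/2)` such that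
  for every real `c` the comparison function
  `g(x) = c x^{-b} + γ + log log x + E(x) - A(x)` (`nicolasFn b c`) is negative for arbitrarily
  large `x`; here `A(x) = ∑_{p ≤ x} -log(1 - 1/p)` and `E(x) = (ψ(x) - x)/(x log x)`.
* `exists_nicolasFn_neg_and_pos`: with the same `b`, `g` is also positive for arbitrarily large
  `x`, for every real `c` (Landau's theorem applied to `-g log`); both for every zero `s₀` of
  `Z₁` right-most on its line and every `b ∈ (-Re s₀, 1/2)` (`exists_nicolasFn_neg_of_zero`,
  `exists_nicolasFn_pos_of_zero`).

Proof. Take a zero `ρ₀ = σ₀ + it₀` of `ζ` with `σ₀ > 1/2` which is the right-most zero on its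
horizontal line (`exists_zero_right_of_not_RH`), any `b ∈ (1 - σ₀, 1/2)`, and put `s₀ = ρ₀ - 1`.
If `g ≥ 0` on some `(X, ∞)`, Landau's theorem (`NicolasMellin.lean`) makes the transform `F₁` of
`g · log` holomorphic on `Re s > -b ∋ s₀`. On `Re s > 1` one has the identity
`s ζ(1+s) · e^{D(s)} = exp G(s)`, `G(s) = (s/(s+1)) Z₁'/Z₁(s) + R(s)` with `R` holomorphic on
`Re s > -b` (built from `F₁`, `D'`, `2^{-s}`), because there `G = N = log(s ζ(1+s)) + D`
(`blowupG_eq_nicolasN`). Both sides are holomorphic on the connected open set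
`{Re s > 1} ∪ (tube around the zero-free ray to the right of s₀) ∪ (half-disc at s₀)`, so the
identity persists there; but near `s₀`, `Z₁'/Z₁ ∼ m/(s - s₀)` and along a suitable direction
`Re G → +∞`, whereas the left side tends to `0`. Contradiction (`false_of_zetaOne_zero`).

## Part II. Transfer to `σ(n)`: Robin 1984, §4 Prop. 1

* `Literature.NumberTheory.LFunctions.Robin1984_sigma_oscillation_holds` (**discharge**): if the Riemann hypothesis is false,
  there are `0 < β < 1/2` and `C > 0` with `σ(n) ≥ e^γ n log log n + C n log log n/(log n)^β`
  for infinitely many `n`.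

Proof (transfer from Nicolas's `Ω`-theorem `exists_nicolasFn_neg`, Part I). Take
`b` from that theorem, `β = b`, `C = 1`. For `x` large put `n = ⌊x⌋`, `N = lcm(1, …, n)`, so
`log N = ψ(x)` and `σ(N)/N = e^{A(n)} ∏_{p ≤ n} (1 - p^{-k_p-1})` with `p^{k_p} ≤ n < p^{k_p+1}`
(`sigma_lcmUpto_div_eq_exp_mul`), whence `log σ(N) - log N ≥ A(x) - 4(1 + log x)/√x`
(`log_sigma_lcmUpto_sub_log_ge`). If `σ(N) < e^γ N log log N (1 + e^{-γ} (log N)^{-b})` then,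
by `log log ψ(x) ≤ log log x + E(x)` (`log_log_psi_le`) and `ψ(x) ≥ x/4`,
`A(x) - γ - log log x - E(x) < c₀ x^{-b}` with `c₀ = 6 + 4/(1/2 - b)`, i.e. `g(x) > 0` for
Nicolas's function `g = nicolasFn b c₀` (`nicolasFn_pos_of_sigma_lt`). Since `g(x) < 0` for
arbitrarily large `x`, Robin's inequality fails at `N = lcm(1, …, ⌊x⌋)` for arbitrarily large `x`.
(Robin uses colossally abundant numbers instead of `lcm(1, …, n)`; any sequence with
`σ(N)/N = e^{A(x)}(1 + O(x^{-1/2+ε}))` and `log N = ψ(x)` or `θ(x)` does.) The sibling file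
`RobinOscillation.lean` runs the same `lcm` transfer from the named fact `Nicolas1983_logf_omega`
(Nicolas's `Ω±`-theorem for `log f` itself, `NicolasMertensRH.lean`); the present file is
unconditional.

Corollaries (unconditional): `riemannHypothesis_of_robinInequality` (Robin's inequality for all
`n > 5040` implies RH) and `riemannHypothesis_of_lagariasInequality` (Lagarias's inequality for
all `n ≥ 1` implies RH); the reductions `robin_iff_of_Robin1984_thm1`,
`lagarias_iff_of_Robin1984_sigma_le` of the two criteria to Robin's Theorem 1 alone; and
`Nicolas1983_logf_omegaMinus`, the `Ω₋` half of Nicolas's Thm. 3 (c) in its printed form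
(`log f(x) ≤ -c x^{-b}` for arbitrarily large `x`, `f = nicolasF` of `NicolasMertensRH.lean`).

## References

* G. Robin, *Grandes valeurs de la fonction somme des diviseurs et hypothèse de Riemann*,
  J. Math. Pures Appl. 63 (1984), 187–213, §4 Prop. 1.
* J.-L. Nicolas, *Petites valeurs de la fonction d'Euler*, J. Number Theory 17 (1983), 375–388:
  Thm. 3 (c) (p. 376) and §4 "Si l'hypothèse de Riemann est fausse" (pp. 383–387): Lemme 2
  (Landau's lemma), formulas (21)–(23), and Prop. 3 (`J(x) = Ω±(x^{-b})` for
  `1 - θ < b < 1/2`).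
* J. C. Lagarias, *An elementary problem equivalent to the Riemann hypothesis*, Amer. Math.
  Monthly 109 (2002), 534–543, Prop. 3.2.
* H. L. Montgomery, R. C. Vaughan, *Multiplicative Number Theory I*, CUP 2007, §15.1 (proof of
  Thm. 15.2: the method).
-/

/-! ## Part I. Nicolas's `Ω`-theorem -/

noncomputable section

open Complex Filter Topology Set MeasureTheory Metric
open scoped ComplexConjugate

namespace Literature.NumberTheory.LFunctions

namespace Nicolas

open Landau

/-! ### Local structure of `Z₁ = zetaOne` at a zero -/

/-- `Z₁` does not vanish identically near any point (`Z₁(0) = 1`, identity theorem). [folklore] -/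
theorem zetaOne_not_eventually_zero (s₀ : ℂ) : ¬ ∀ᶠ z in 𝓝 s₀, zetaOne z = 0 := by
  intro h
  have han : AnalyticOnNhd ℂ zetaOne univ := fun z _ ↦ analyticAt_zetaOne z
  have hall := han.eqOn_zero_of_preconnected_of_eventuallyEq_zero isPreconnected_univ
    (mem_univ s₀) h
  have := hall (mem_univ 0)
  simp at this

/-- Near a zero `s₀` of `Z₁`, of multiplicity `m ≥ 1`: `Z₁(z) = (z - s₀)^m h(z)` with `h`
holomorphic and zero-free on a disc about `s₀`, and `Z₁'/Z₁ = m/(z - s₀) + h'/h` on the punctured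
disc. [folklore] -/
theorem exists_logDeriv_zetaOne_eq {s₀ : ℂ} (h0 : zetaOne s₀ = 0) :
    ∃ (m : ℕ) (h : ℂ → ℂ) (r : ℝ), 0 < m ∧ 0 < r ∧ AnalyticAt ℂ h s₀ ∧ h s₀ ≠ 0 ∧
      (∀ z ∈ ball s₀ r, h z ≠ 0) ∧ (∀ z ∈ ball s₀ r, DifferentiableAt ℂ h z) ∧
      (∀ z ∈ ball s₀ r, zetaOne z = (z - s₀) ^ m * h z) ∧
      ∀ z ∈ ball s₀ r, z ≠ s₀ →
        deriv zetaOne z / zetaOne z = m / (z - s₀) + deriv h z / h z := by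
  obtain ⟨m, h, hh, hh0, hfac⟩ :=
    (analyticAt_zetaOne s₀).exists_eventuallyEq_pow_smul_nonzero_iff.2
      (zetaOne_not_eventually_zero s₀)
  have hm : 0 < m := by
    rcases Nat.eq_zero_or_pos m with rfl | hm
    · exfalso
      apply hh0
      have := hfac.self_of_nhds
      simp only [pow_zero, one_smul] at this
      rw [← this]
      exact h0
    · exact hm
  have h1 : ∀ᶠ z in 𝓝 s₀, h z ≠ 0 := hh.continuousAt.eventually_ne hh0
  have h2 : ∀ᶠ z in 𝓝 s₀, AnalyticAt ℂ h z := hh.eventually_analyticAt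
  obtain ⟨r, hr, hball⟩ := Metric.eventually_nhds_iff_ball.1 (hfac.and (h1.and h2))
  refine ⟨m, h, r, hm, hr, hh, hh0, fun z hz ↦ (hball z hz).2.1,
    fun z hz ↦ (hball z hz).2.2.differentiableAt,
    fun z hz ↦ by rw [(hball z hz).1, smul_eq_mul], fun z hz hne ↦ ?_⟩
  have hzs : z - s₀ ≠ 0 := sub_ne_zero.2 hne
  have hhz : h z ≠ 0 := (hball z hz).2.1
  have hev : zetaOne =ᶠ[𝓝 z] fun w ↦ (w - s₀) ^ m * h w := by
    filter_upwards [isOpen_ball.mem_nhds hz] with w hw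
    rw [(hball w hw).1, smul_eq_mul]
  have hd : HasDerivAt (fun w ↦ (w - s₀) ^ m * h w)
      ((m : ℂ) * (z - s₀) ^ (m - 1) * 1 * h z + (z - s₀) ^ m * deriv h z) z :=
    (((hasDerivAt_id z).sub_const s₀).pow m).mul (hball z hz).2.2.differentiableAt.hasDerivAt
  rw [hev.deriv_eq, hd.deriv, (hball z hz).1, smul_eq_mul]
  have hpow : (z - s₀) ^ m = (z - s₀) ^ (m - 1) * (z - s₀) := by
    rw [← pow_succ, Nat.sub_add_cancel hm]
  rw [hpow]
  have hp0 : (z - s₀) ^ (m - 1) ≠ 0 := pow_ne_zero _ hzs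
  field_simp

/-! ### The functions `R` and `G` of the blow-up argument -/

/-- `R(s) = s D'(s) - s² (F₁(s) - c/(s+b)²) + s (1 - (s+1) 2^{-s})/(s+1)`, holomorphic on
`Re s > -b` as soon as `F₁` (the transform of `g₁ = g log`) is. [cite: Nicolas1983, §4] -/
def blowupR (b c : ℝ) (s : ℂ) : ℂ :=
  s * deriv primeLogDiff s - s ^ 2 * (mellinIoi (nicolasFnLog b c) s - c / (s + b) ^ 2)
    + s * (1 - (s + 1) * (2 : ℂ) ^ (-s)) / (s + 1)

/-- `G(s) = (s/(s+1)) Z₁'(s)/Z₁(s) + R(s)`; on `Re s > 1` it equals `N(s) = log Z₁(s) + D(s)`.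
[cite: Nicolas1983, §4] -/
def blowupG (b c : ℝ) (s : ℂ) : ℂ :=
  s / (s + 1) * (deriv zetaOne s / zetaOne s) + blowupR b c s

/-- Auxiliary (proof-internal). [folklore] -/
theorem differentiableAt_deriv_primeLogDiff {s : ℂ} (hs : -1 / 2 < s.re) :
    DifferentiableAt ℂ (deriv primeLogDiff) s :=
  ((differentiableOn_primeLogDiff.analyticOnNhd (isOpen_re_gt' _)).deriv s hs).differentiableAt

/-- **`G = N` on `Re s > 1`.** There `F₁ = c/(s+b)² + M' - e` (`mellinIoi_nicolasFnLog`),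
`s² M' = s N' - N` (`M = N/s`), `N' = Z₁'/Z₁ + D'` and
`s² e(s) = s (s Z₁'/Z₁ - 1 + (s+1) 2^{-s})/(s+1)`, whence
`N = s N' - s² M' = (s/(s+1)) Z₁'/Z₁ + R`. [cite: Nicolas1983, §4] -/
theorem blowupG_eq_nicolasN {b c : ℝ} (hb0 : 0 < b) {s : ℂ} (hs : 1 < s.re) :
    blowupG b c s = nicolasN s := by
  have hs0 : s ≠ 0 := by rintro rfl; simp at hs; linarith
  have hs1 : s + 1 ≠ 0 := by
    intro h; have := congrArg Complex.re h; simp at this; linarith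
  have hD : s ∈ nicolasDom := mem_nicolasDom_of_one_lt_re hs
  have hZ : zetaOne s ≠ 0 := zetaOne_ne_zero_of_mem_nicolasDom hD
  -- `M' = F₁ - c/(s+b)² + e`
  have hM' : deriv nicolasM s =
      mellinIoi (nicolasFnLog b c) s - c / (s + b) ^ 2 + psiKernel s := by
    rw [mellinIoi_nicolasFnLog hb0 hs, nicolasCont]
    ring
  -- `N' = Z₁'/Z₁ + D'`
  have hNd : HasDerivAt nicolasN (deriv zetaOne s / zetaOne s + deriv primeLogDiff s) s := by
    unfold nicolasN
    refine ((differentiable_zetaOne s).hasDerivAt.clog hD.2).add ?_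
    exact (differentiableOn_primeLogDiff.differentiableAt
      ((isOpen_re_gt' _).mem_nhds hD.1)).hasDerivAt
  -- `M' = (s N' - N)/s²`
  have hMev : nicolasM =ᶠ[𝓝 s] fun z ↦ nicolasN z / z := by
    filter_upwards [isOpen_ne.mem_nhds hs0] with z hz
    exact nicolasM_of_ne_zero hz
  have hMd : HasDerivAt (fun z ↦ nicolasN z / z)
      (((deriv zetaOne s / zetaOne s + deriv primeLogDiff s) * s - nicolasN s * 1) / s ^ 2) s :=
    hNd.div (hasDerivAt_id s) hs0
  have hM'2 : deriv nicolasM s =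
      ((deriv zetaOne s / zetaOne s + deriv primeLogDiff s) * s - nicolasN s) / s ^ 2 := by
    rw [hMev.deriv_eq, hMd.deriv, mul_one]
  -- solve for `N`
  have hN : nicolasN s = (deriv zetaOne s / zetaOne s + deriv primeLogDiff s) * s -
      s ^ 2 * (mellinIoi (nicolasFnLog b c) s - c / (s + b) ^ 2 + psiKernel s) := by
    have h := hM'2.symm.trans hM'
    have hs2 : s ^ 2 ≠ 0 := pow_ne_zero 2 hs0
    rw [div_eq_iff hs2] at h
    linear_combination -h
  rw [hN, psiKernel_of_ne_zero hs0, psiKernelNum, blowupG, blowupR]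
  field_simp
  ring

/-- **`Z₁ e^{D} = e^{G}` on `Re s > 1`** (`exp N = exp (log Z₁) e^{D} = Z₁ e^{D}`).
[cite: Nicolas1983, §4] -/
theorem exp_blowupG {b c : ℝ} (hb0 : 0 < b) {s : ℂ} (hs : 1 < s.re) :
    zetaOne s * exp (primeLogDiff s) = exp (blowupG b c s) := by
  rw [blowupG_eq_nicolasN hb0 hs, nicolasN, exp_add,
    exp_log (zetaOne_ne_zero_of_mem_nicolasDom (mem_nicolasDom_of_one_lt_re hs))]

/-- `R` is holomorphic on `Re s > -b` when `F₁` is. [folklore] -/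
theorem differentiableOn_blowupR {b c : ℝ} (hb : b < 1 / 2)
    (hF : DifferentiableOn ℂ (mellinIoi (nicolasFnLog b c)) {s : ℂ | -b < s.re}) :
    DifferentiableOn ℂ (blowupR b c) {s : ℂ | -b < s.re} := by
  intro s hs
  have hs' : -b < s.re := hs
  have hs1 : s + 1 ≠ 0 := by
    intro h; have := congrArg Complex.re h; simp at this; linarith
  have hsb : s + b ≠ 0 := by
    intro h; have := congrArg Complex.re h; simp at this; linarith
  refine DifferentiableAt.differentiableWithinAt ?_
  unfold blowupR
  refine ((differentiableAt_id.mul (differentiableAt_deriv_primeLogDiff (by linarith))).sub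
    ((differentiableAt_id.pow 2).mul ((hF.differentiableAt ((isOpen_re_gt' _).mem_nhds hs)).sub
      ((differentiableAt_const _).div ((differentiableAt_id.add (differentiableAt_const _)).pow 2)
        (pow_ne_zero 2 hsb))))).add ?_
  refine (differentiableAt_id.mul ((differentiableAt_const _).sub
    ((differentiableAt_id.add (differentiableAt_const _)).mul ?_))).div
    (differentiableAt_id.add (differentiableAt_const _)) hs1
  exact differentiableAt_id.neg.const_cpow (Or.inl two_ne_zero)

/-- `G` is holomorphic on `{Re s > -b} ∩ {Z₁ ≠ 0}` when `F₁` is holomorphic on `Re s > -b`.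
[folklore] -/
theorem differentiableOn_blowupG {b c : ℝ} (hb : b < 1 / 2)
    (hF : DifferentiableOn ℂ (mellinIoi (nicolasFnLog b c)) {s : ℂ | -b < s.re}) :
    DifferentiableOn ℂ (blowupG b c) ({s : ℂ | -b < s.re} ∩ {s : ℂ | zetaOne s ≠ 0}) := by
  intro s hs
  have hs' : -b < s.re := hs.1
  have hs1 : s + 1 ≠ 0 := by
    intro h; have := congrArg Complex.re h; simp at this; linarith
  refine DifferentiableAt.differentiableWithinAt ?_
  have h1 : DifferentiableAt ℂ (fun z : ℂ ↦ z / (z + 1)) s :=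
    differentiableAt_id.div (differentiableAt_id.add_const 1) hs1
  have h2 : DifferentiableAt ℂ (fun z ↦ deriv zetaOne z / zetaOne z) s :=
    ((analyticAt_zetaOne s).deriv.differentiableAt).div (differentiable_zetaOne s) hs.2
  have h3 : DifferentiableAt ℂ (blowupR b c) s :=
    (differentiableOn_blowupR hb hF).differentiableAt ((isOpen_re_gt' _).mem_nhds hs.1)
  exact (h1.mul h2).add h3

/-! ### The blow-up at `s₀` -/

/-- A zero `s₀` of `Z₁` with `Re s₀ > -1/2` is not real. [folklore] -/
theorem im_ne_zero_of_zetaOne_eq_zero {s₀ : ℂ} (h0 : zetaOne s₀ = 0) (hre : -1 / 2 < s₀.re) :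
    s₀.im ≠ 0 := by
  intro him
  have : s₀ = ((s₀.re : ℝ) : ℂ) := Complex.ext (by simp) (by simp [him])
  rw [this] at h0
  exact (zetaOne_ofReal_ne_zero (by linarith)) h0

/-- `Im (m s₀/(s₀+1)) = m Im s₀ / |s₀ + 1|²`. [folklore] -/
theorem blowup_kappa_im (s₀ : ℂ) (m : ℕ) (hs1 : s₀ + 1 ≠ 0) :
    ((m : ℂ) * s₀ / (s₀ + 1)).im = m * s₀.im / normSq (s₀ + 1) := by
  have hn : normSq (s₀ + 1) ≠ 0 := (normSq_pos.2 hs1).ne'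
  rw [Complex.div_im]
  simp only [mul_im, natCast_re, natCast_im, zero_mul, add_zero, add_re, one_re, mul_re,
    sub_zero, add_im, one_im]
  field_simp
  ring

/-- `‖κ‖ + Re κ > 0` unless `κ` is a non-positive real. [folklore] -/
theorem norm_add_re_pos {κ : ℂ} (h : κ.im ≠ 0) : 0 < ‖κ‖ + κ.re := by
  have h1 : |κ.re| < ‖κ‖ := abs_re_lt_norm.2 h
  have h2 := neg_abs_le κ.re
  linarith

/-- **The blow-up.** Let `0 < b < 1/2`, let `s₀` be a zero of `Z₁(s) = s ζ(1+s)` with `Re s₀ > -b`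
such that `Z₁ ≠ 0` on the horizontal ray to the right of `s₀`, and suppose the transform `F₁` of
`g₁ = g · log` is holomorphic on `Re s > -b`. Then `Z₁ e^{D} = e^{G}` persists from `Re s > 1` to
a half-disc at `s₀` (identity theorem along a tube around the ray), where the left side tends to
`0` but `Re G → +∞` along the direction `u = κ/|κ| + 1`, `κ = m s₀/(s₀+1)`: contradiction.
[cite: Nicolas1983, §4 (proof of Thm. 3 (c): Lemme 2, Prop. 3)]
[cite: MontgomeryVaughan2007, §15.1, proof of Thm. 15.2] -/
theorem false_of_zetaOne_zero {b c : ℝ} (hb0 : 0 < b) (hb : b < 1 / 2) {s₀ : ℂ}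
    (hZ : zetaOne s₀ = 0) (hre : -b < s₀.re) (hray : ∀ t : ℝ, 0 < t → zetaOne (s₀ + t) ≠ 0)
    (hF : DifferentiableOn ℂ (mellinIoi (nicolasFnLog b c)) {s : ℂ | -b < s.re}) : False := by
  -- local structure at `s₀`
  obtain ⟨m, h, r₁, hm, hr₁, hh, hh0, hhne, hhd, hfac, hlog⟩ := exists_logDeriv_zetaOne_eq hZ
  have hs00 : s₀ ≠ 0 := by rintro rfl; simp at hZ
  have hs01 : s₀ + 1 ≠ 0 := by
    intro h; have := congrArg Complex.re h; simp at this; linarith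
  have him : s₀.im ≠ 0 := im_ne_zero_of_zetaOne_eq_zero hZ (by linarith)
  have hre0 : s₀.re < 0 := by
    by_contra hge
    push Not at hge
    refine riemannZeta_ne_zero_of_one_le_re (s := 1 + s₀) ?_ (zetaOne_eq_zero_iff.1 hZ).2
    simp only [add_re, one_re]
    linarith
  -- `κ` and the direction `u`
  set κ : ℂ := (m : ℂ) * s₀ / (s₀ + 1) with hκ
  have hκim : κ.im ≠ 0 := by
    rw [hκ, blowup_kappa_im s₀ m hs01]
    have h1 : 0 < normSq (s₀ + 1) := normSq_pos.2 hs01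
    have h2 : (m : ℝ) ≠ 0 := by exact_mod_cast hm.ne'
    exact div_ne_zero (mul_ne_zero h2 him) h1.ne'
  have hκpos : 0 < ‖κ‖ + κ.re := norm_add_re_pos hκim
  have hκ0 : κ ≠ 0 := by intro h; rw [h] at hκim; simp at hκim
  have hκn : 0 < ‖κ‖ := norm_pos_iff.2 hκ0
  set u : ℂ := κ * ((‖κ‖⁻¹ : ℝ) : ℂ) + 1 with hu
  have hure : 0 < u.re := by
    have h1 : u.re = κ.re * ‖κ‖⁻¹ + 1 := by rw [hu]; simp
    rw [h1]
    have h2 : -‖κ‖ < κ.re := by linarith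
    have h3 : -1 < κ.re * ‖κ‖⁻¹ := by
      rw [← div_eq_mul_inv, lt_div_iff₀ hκn]; linarith
    linarith
  have hu0 : u ≠ 0 := by intro h; rw [h] at hure; simp at hure
  have hnu : 0 < normSq u := normSq_pos.2 hu0
  have hunorm : 0 < ‖u‖ := norm_pos_iff.2 hu0
  have hκu : κ * conj u = ((‖κ‖ : ℝ) : ℂ) + κ := by
    have h1 : conj u = conj κ * ((‖κ‖⁻¹ : ℝ) : ℂ) + 1 := by
      rw [hu, map_add, map_one, map_mul, conj_ofReal]
    rw [h1, mul_add, mul_one, ← mul_assoc, mul_conj, normSq_eq_norm_sq, ← ofReal_mul]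
    congr 1
    push_cast
    field_simp
  have hlamre : 0 < (κ * conj u).re := by
    rw [hκu, add_re, ofReal_re]
    exact hκpos
  -- radius of the half-disc at `s₀`
  set r₀ : ℝ := min r₁ (s₀.re + b) with hr₀def
  have hr₀ : 0 < r₀ := lt_min hr₁ (by linarith)
  have hr₀₁ : r₀ ≤ r₁ := min_le_left _ _
  have hr₀b : r₀ ≤ s₀.re + b := min_le_right _ _
  -- the sets
  set P : Set ℂ := {z : ℂ | 1 < z.re} with hP
  set Hsp : Set ℂ := {z : ℂ | (s₀ * conj u).re < (z * conj u).re} with hHsp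
  set A₂ : Set ℂ := ball s₀ r₀ ∩ Hsp with hA₂
  set K₁ : Set ℂ := Icc (s₀.re + r₀ / 2) (s₀.re + b + 2) ×ℂ {s₀.im} with hK₁
  set O : Set ℂ := {z : ℂ | -b < z.re} ∩ {z : ℂ | zetaOne z ≠ 0} with hO
  have hOo : IsOpen O := (isOpen_re_gt' _).inter isOpen_zetaOne_ne_zero
  have hK₁O : K₁ ⊆ O := by
    intro z hz
    rw [hK₁, mem_reProdIm] at hz
    obtain ⟨⟨hz1, hz2⟩, hz3⟩ := hz
    have hz3' : z.im = s₀.im := hz3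
    have hzt : z = s₀ + ((z.re - s₀.re : ℝ) : ℂ) := Complex.ext (by simp) (by simp [hz3'])
    refine ⟨show -b < z.re by linarith, ?_⟩
    show zetaOne z ≠ 0
    rw [hzt]
    exact hray _ (by linarith)
  have hK₁c : IsCompact K₁ := isCompact_Icc.reProdIm isCompact_singleton
  have hK₁conv : Convex ℝ K₁ :=
    ((convex_Icc _ _).linear_preimage Complex.reLm).inter
      ((convex_singleton (s₀.im)).linear_preimage Complex.imLm)
  obtain ⟨δ₁, hδ₁, hA₁O⟩ := hK₁c.exists_thickening_subset_open hOo hK₁O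
  set A₁ : Set ℂ := thickening δ₁ K₁ with hA₁
  set U : Set ℂ := (P ∪ A₁) ∪ A₂ with hU
  have hA₂O : A₂ ⊆ O := by
    intro z hz
    have hzb : z ∈ ball s₀ r₀ := hz.1
    have hzs : z ≠ s₀ := by
      intro h
      have := hz.2
      rw [hHsp, mem_setOf_eq, h] at this
      exact lt_irrefl _ this
    rw [mem_ball, Complex.dist_eq] at hzb
    refine ⟨?_, ?_⟩
    · show -b < z.re
      have h1 := abs_re_le_norm (z - s₀)
      rw [sub_re] at h1
      have h2 := neg_abs_le (z.re - s₀.re)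
      linarith
    · show zetaOne z ≠ 0
      have hz1 : z ∈ ball s₀ r₁ := by
        rw [mem_ball, Complex.dist_eq]; linarith
      rw [hfac z hz1]
      exact mul_ne_zero (pow_ne_zero _ (sub_ne_zero.2 hzs)) (hhne z hz1)
  have hPO : P ⊆ O := by
    intro z hz
    have hz' : 1 < z.re := hz
    exact ⟨show -b < z.re by linarith,
      zetaOne_ne_zero_of_mem_nicolasDom (mem_nicolasDom_of_one_lt_re hz')⟩
  have hUO : U ⊆ O := union_subset (union_subset hPO hA₁O) hA₂O
  have hHo : IsOpen Hsp :=
    isOpen_lt continuous_const (continuous_re.comp (continuous_id.mul continuous_const))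
  have hUo : IsOpen U := ((isOpen_re_gt' 1).union isOpen_thickening).union (isOpen_ball.inter hHo)
  have hHconv : Convex ℝ Hsp :=
    (convex_halfSpace_re_gt _).linear_preimage (LinearMap.mulRight ℝ (conj u))
  -- two witnesses of connectedness
  have p₁K : s₀ + ((b + 2 : ℝ) : ℂ) ∈ K₁ := by
    rw [hK₁, mem_reProdIm]
    refine ⟨⟨?_, ?_⟩, ?_⟩
    · simp only [add_re, ofReal_re]; linarith
    · simp only [add_re, ofReal_re]; linarith
    · simp
  have p₂K : s₀ + ((r₀ / 2 : ℝ) : ℂ) ∈ K₁ := by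
    rw [hK₁, mem_reProdIm]
    refine ⟨⟨?_, ?_⟩, ?_⟩
    · simp only [add_re, ofReal_re]; linarith
    · simp only [add_re, ofReal_re]; linarith
    · simp
  have hUconn : IsPreconnected U := by
    refine IsPreconnected.union' ?_ (IsPreconnected.union' ?_
      (convex_halfSpace_re_gt 1).isPreconnected (hK₁conv.thickening δ₁).isPreconnected)
      ((convex_ball _ _).inter hHconv).isPreconnected
    · refine ⟨s₀ + ((r₀ / 2 : ℝ) : ℂ), Or.inr (self_subset_thickening hδ₁ _ p₂K), ?_, ?_⟩
      · rw [mem_ball, Complex.dist_eq, add_sub_cancel_left, norm_real, Real.norm_eq_abs,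
          abs_of_pos (by linarith)]
        linarith
      · show (s₀ * conj u).re < ((s₀ + ((r₀ / 2 : ℝ) : ℂ)) * conj u).re
        rw [add_mul, add_re, re_ofReal_mul, conj_re]
        have : 0 < r₀ / 2 * u.re := mul_pos (by linarith) hure
        linarith
    · exact ⟨s₀ + ((b + 2 : ℝ) : ℂ), show 1 < (s₀ + ((b + 2 : ℝ) : ℂ)).re by simp; linarith,
        self_subset_thickening hδ₁ _ p₁K⟩
  -- the two holomorphic functions and the identity theorem
  set f : ℂ → ℂ := fun z ↦ zetaOne z * exp (primeLogDiff z) with hf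
  set g : ℂ → ℂ := fun z ↦ exp (blowupG b c z) with hg
  have hDd : ∀ z : ℂ, -b < z.re → DifferentiableAt ℂ primeLogDiff z := fun z hz ↦
    differentiableOn_primeLogDiff.differentiableAt
      ((isOpen_re_gt' _).mem_nhds (show -1 / 2 < z.re by linarith))
  have hfU : AnalyticOnNhd ℂ f U := by
    refine DifferentiableOn.analyticOnNhd (fun z hz ↦ ?_) hUo
    exact ((differentiable_zetaOne z).mul (hDd z (hUO hz).1).cexp).differentiableWithinAt
  have hgU : AnalyticOnNhd ℂ g U :=
    (((differentiableOn_blowupG hb hF).mono hUO).cexp).analyticOnNhd hUo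
  have h2P : (2 : ℂ) ∈ P := by show (1 : ℝ) < (2 : ℂ).re; norm_num
  have h2U : (2 : ℂ) ∈ U := Or.inl (Or.inl h2P)
  have hfg2 : f =ᶠ[𝓝 2] g := by
    filter_upwards [(isOpen_re_gt' 1).mem_nhds h2P] with z hz
    exact exp_blowupG hb0 hz
  have hEq : EqOn f g U := hfU.eqOn_of_preconnected_of_eventuallyEq hgU hUconn h2U hfg2
  -- the path `z_δ = s₀ + δ u`
  set zδ : ℝ → ℂ := fun δ ↦ s₀ + (δ : ℂ) * u with hzδ
  have hzδ_sub : ∀ δ : ℝ, zδ δ - s₀ = (δ : ℂ) * u := fun δ ↦ by simp [hzδ]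
  have hzδ_norm : ∀ δ : ℝ, ‖zδ δ - s₀‖ = |δ| * ‖u‖ := fun δ ↦ by
    rw [hzδ_sub, norm_mul, norm_real, Real.norm_eq_abs]
  have hmemA₂ : ∀ δ : ℝ, 0 < δ → δ < r₀ / ‖u‖ → zδ δ ∈ A₂ := by
    intro δ hδ hδ'
    refine ⟨?_, ?_⟩
    · rw [mem_ball, Complex.dist_eq, hzδ_norm, abs_of_pos hδ]
      rwa [lt_div_iff₀ hunorm] at hδ'
    · show (s₀ * conj u).re < (zδ δ * conj u).re
      rw [hzδ]
      simp only
      rw [add_mul, add_re, mul_assoc, mul_conj, ← ofReal_mul, ofReal_re]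
      have : 0 < δ * normSq u := mul_pos hδ hnu
      linarith
  have hzδ_tendsto : Tendsto zδ (𝓝[>] 0) (𝓝 s₀) := by
    have hc : Continuous zδ := continuous_const.add (continuous_ofReal.mul continuous_const)
    have := hc.tendsto 0
    simp only [hzδ, ofReal_zero, zero_mul, add_zero] at this
    exact this.mono_left nhdsWithin_le_nhds
  -- decomposition of `G` along the path
  set φ : ℂ → ℂ := fun z ↦ (m : ℂ) * z / (z + 1) with hφ
  set R₂ : ℂ → ℂ := fun z ↦ z / (z + 1) * (deriv h z / h z) + blowupR b c z with hR₂
  have hφs₀ : φ s₀ = κ := rfl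
  have hdecomp : ∀ δ : ℝ, 0 < δ → δ < r₀ / ‖u‖ →
      blowupG b c (zδ δ) =
        κ / ((δ : ℂ) * u) + ((φ (zδ δ) - κ) / ((δ : ℂ) * u) + R₂ (zδ δ)) := by
    intro δ hδ hδ'
    have hA := hmemA₂ δ hδ hδ'
    have hz1 : zδ δ ∈ ball s₀ r₁ := ball_subset_ball hr₀₁ hA.1
    have hne : zδ δ ≠ s₀ := by
      intro h
      have := hzδ_norm δ
      rw [h, sub_self, norm_zero, abs_of_pos hδ] at this
      have : 0 < δ * ‖u‖ := mul_pos hδ hunorm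
      linarith
    have hδu : (δ : ℂ) * u ≠ 0 := mul_ne_zero (by exact_mod_cast hδ.ne') hu0
    have hzre : -b < (zδ δ).re := (hA₂O hA).1
    have hz1' : zδ δ + 1 ≠ 0 := by
      intro h; have := congrArg Complex.re h; simp at this; linarith
    have hhz : h (zδ δ) ≠ 0 := hhne _ hz1
    rw [blowupG, hlog _ hz1 hne, hzδ_sub]
    simp only [hR₂, hφ, hκ]
    field_simp
    ring
  -- (1) the polar part: `Re (κ/(δu)) = λ/δ` with `λ > 0`
  set lam : ℝ := (κ * conj u).re / normSq u with hlam
  have hlam0 : 0 < lam := div_pos hlamre hnu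
  have hre1 : ∀ δ : ℝ, δ ≠ 0 → (κ / ((δ : ℂ) * u)).re = lam * δ⁻¹ := by
    intro δ hδ
    have hcu : conj u ≠ 0 := (map_ne_zero _).2 hu0
    have h1 : κ / ((δ : ℂ) * u) = κ * conj u / ((δ * normSq u : ℝ) : ℂ) := by
      rw [ofReal_mul, ← mul_conj]
      field_simp
    rw [h1, div_ofReal_re, hlam]
    field_simp
  have T1 : Tendsto (fun δ : ℝ ↦ lam * δ⁻¹) (𝓝[>] 0) atTop :=
    tendsto_inv_nhdsGT_zero.const_mul_atTop hlam0
  -- (2) the slope part converges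
  have hφd : DifferentiableAt ℂ φ s₀ :=
    ((differentiableAt_const _).mul differentiableAt_id).div (differentiableAt_id.add_const 1) hs01
  set ψ : ℝ → ℂ := fun t ↦ φ (s₀ + (t : ℂ) * u) with hψ
  have hψd : HasDerivAt ψ (deriv φ s₀ * u) 0 := by
    have h1 : HasDerivAt (fun w : ℂ ↦ s₀ + w * u) (1 * u) 0 :=
      ((hasDerivAt_id (0 : ℂ)).mul_const u).const_add s₀
    have hφd' : HasDerivAt φ (deriv φ s₀) (s₀ + 0 * u) := by
      rw [zero_mul, add_zero]; exact hφd.hasDerivAt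
    have h2 := hφd'.comp 0 h1
    have h2' : HasDerivAt (fun w : ℂ ↦ φ (s₀ + w * u)) (deriv φ s₀ * u) 0 := by
      simpa [Function.comp_def] using h2
    have h3 := h2'.comp_ofReal (z := 0)
    simpa [hψ] using h3
  have T2 : Tendsto (fun δ : ℝ ↦ ((φ (zδ δ) - κ) / ((δ : ℂ) * u)).re) (𝓝[>] 0)
      (𝓝 ((deriv φ s₀ * u / u).re)) := by
    have h1 := ((hψd.tendsto_slope_zero_right).div_const u)
    have h2 := (continuous_re.tendsto _).comp h1
    refine h2.congr' ?_
    filter_upwards [self_mem_nhdsWithin] with δ (hδ : 0 < δ)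
    simp only [Function.comp_apply, hψ, hzδ, zero_add, ofReal_zero, zero_mul, add_zero, hφs₀]
    congr 1
    rw [Complex.real_smul]
    field_simp
    push_cast
    ring
  -- (3) the regular part converges
  have hR₂c : ContinuousAt R₂ s₀ := by
    have h1 : DifferentiableAt ℂ (fun z : ℂ ↦ z / (z + 1)) s₀ :=
      differentiableAt_id.div (differentiableAt_id.add_const 1) hs01
    have h2 : DifferentiableAt ℂ (fun z ↦ deriv h z / h z) s₀ :=
      (hh.deriv.differentiableAt).div hh.differentiableAt hh0
    have h3 : DifferentiableAt ℂ (blowupR b c) s₀ :=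
      (differentiableOn_blowupR hb hF).differentiableAt ((isOpen_re_gt' _).mem_nhds hre)
    exact ((h1.mul h2).add h3).continuousAt
  have T3 : Tendsto (fun δ : ℝ ↦ (R₂ (zδ δ)).re) (𝓝[>] 0) (𝓝 (R₂ s₀).re) :=
    (continuous_re.tendsto _).comp (hR₂c.tendsto.comp hzδ_tendsto)
  -- hence `Re G(z_δ) → +∞`
  have hG : Tendsto (fun δ : ℝ ↦ (blowupG b c (zδ δ)).re) (𝓝[>] 0) atTop := by
    have hsum := T1.atTop_add (T2.add T3)
    refine hsum.congr' ?_
    filter_upwards [Ioo_mem_nhdsGT (div_pos hr₀ hunorm)] with δ hδ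
    rw [hdecomp δ hδ.1 hδ.2]
    simp only [add_re, hR₂]
    rw [hre1 δ hδ.1.ne']
  -- conclusion
  have E1 : ∀ᶠ δ : ℝ in 𝓝[>] 0, 1 ≤ ‖g (zδ δ)‖ := by
    filter_upwards [hG.eventually_ge_atTop 0] with δ hδ
    simp only [hg, norm_exp]
    exact Real.one_le_exp hδ
  have E2 : ∀ᶠ δ : ℝ in 𝓝[>] 0, ‖f (zδ δ)‖ < 1 := by
    have hfc : ContinuousAt f s₀ :=
      (continuous_zetaOne.continuousAt).mul (hDd s₀ hre).continuousAt.cexp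
    have hf0 : f s₀ = 0 := by simp [hf, hZ]
    have ht : Tendsto (fun δ ↦ f (zδ δ)) (𝓝[>] 0) (𝓝 0) := by
      rw [← hf0]; exact hfc.tendsto.comp hzδ_tendsto
    filter_upwards [ht (Metric.ball_mem_nhds 0 one_pos)] with δ hδ
    simpa using hδ
  have E3 : ∀ᶠ δ : ℝ in 𝓝[>] 0, zδ δ ∈ U := by
    filter_upwards [Ioo_mem_nhdsGT (div_pos hr₀ hunorm)] with δ hδ
    exact Or.inr (hmemA₂ δ hδ.1 hδ.2)
  obtain ⟨δ, h1, h2, h3⟩ := (E1.and (E2.and E3)).exists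
  rw [← hEq h3] at h1
  linarith

/-! ### A right-most zero off the critical line -/

/-- From `¬RH`: a zero `ρ` of `ζ` with `1/2 < Re ρ < 1` (functional equation via `ξ(1-s) = ξ(s)`),
and then the right-most zero `ρ₀ = σ₀ + i Im ρ` of `ζ` on the horizontal line through `ρ` with
`σ₀ ≥ Re ρ` (a closed bounded set of abscissae; `ζ ≠ 0` on `Re s ≥ 1`). In terms of
`s₀ = ρ₀ - 1`: `Z₁(s₀) = 0`, `-1/2 < Re s₀ < 0`, and `Z₁ ≠ 0` on the ray to the right of `s₀`.
[folklore] -/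
theorem exists_zero_right_of_not_RH (hRH : ¬ RiemannHypothesis) :
    ∃ s₀ : ℂ, zetaOne s₀ = 0 ∧ -1 / 2 < s₀.re ∧ s₀.re < 0 ∧
      ∀ t : ℝ, 0 < t → zetaOne (s₀ + t) ≠ 0 := by
  -- a zero `ρ` of `ζ` with `1/2 < Re ρ < 1`
  obtain ⟨ρ, hρ, hρ1, hρ2⟩ : ∃ ρ : ℂ, riemannZeta ρ = 0 ∧ 1 / 2 < ρ.re ∧ ρ.re < 1 := by
    obtain ⟨s, hs, htriv, hs1, hsre⟩ : ∃ s : ℂ, riemannZeta s = 0 ∧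
        (¬∃ n : ℕ, s = -2 * (n + 1)) ∧ s ≠ 1 ∧ s.re ≠ 1 / 2 := by
      by_contra hcon
      refine hRH fun s hs htriv hs1 ↦ ?_
      by_contra hre
      exact hcon ⟨s, hs, htriv, hs1, hre⟩
    have hxi := Literature.NumberTheory.LFunctions.riemannXi_eq_zero_of_nontrivial hs htriv hs1
    obtain ⟨hz, h0, h1⟩ := (Literature.NumberTheory.LFunctions.riemannXi_eq_zero_iff_holds s).1 hxi
    rcases lt_or_gt_of_ne hsre with hlt | hgt
    · refine ⟨1 - s, ?_, ?_, ?_⟩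
      · have hxi' : riemannXi (1 - s) = 0 := by rwa [riemannXi_one_sub]
        exact ((Literature.NumberTheory.LFunctions.riemannXi_eq_zero_iff_holds (1 - s)).1 hxi').1
      · simp only [sub_re, one_re]; linarith
      · simp only [sub_re, one_re]; linarith
    · exact ⟨s, hz, hgt, h1⟩
  have hρim : ρ.im ≠ 0 := Literature.NumberTheory.LFunctions.im_ne_zero_of_riemannZeta_eq_zero hρ (by linarith) hρ2
  -- the right-most zero on the line `Im = ρ.im`, with abscissa in `[Re ρ, 1]`
  set t₀ : ℝ := ρ.im with ht₀
  set S : Set ℝ := Icc ρ.re 1 ∩ {σ : ℝ | riemannZeta (σ + t₀ * I) = 0} with hS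
  have hcont : Continuous fun σ : ℝ ↦ riemannZeta (σ + t₀ * I) := by
    refine continuous_iff_continuousAt.2 fun σ ↦ ?_
    have hne : (σ : ℂ) + t₀ * I ≠ 1 := by
      intro h; have := congrArg Complex.im h; simp at this; exact hρim this
    have hpath : Continuous fun σ : ℝ ↦ (σ : ℂ) + t₀ * I :=
      continuous_ofReal.add continuous_const
    exact ContinuousAt.comp (f := fun σ : ℝ ↦ (σ : ℂ) + t₀ * I)
      (differentiableAt_riemannZeta hne).continuousAt hpath.continuousAt
  have hSc : IsClosed S := isClosed_Icc.inter (isClosed_eq hcont continuous_const)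
  have hρS : ρ.re ∈ S := by
    refine ⟨⟨le_rfl, hρ2.le⟩, ?_⟩
    show riemannZeta (↑ρ.re + ↑t₀ * I) = 0
    rw [ht₀, re_add_im]
    exact hρ
  have hSne : S.Nonempty := ⟨_, hρS⟩
  have hSbdd : BddAbove S := ⟨1, fun σ hσ ↦ hσ.1.2⟩
  set σ₀ : ℝ := sSup S with hσ₀
  have hσ₀S : σ₀ ∈ S := hSc.csSup_mem hSne hSbdd
  have hσ₀ρ : ρ.re ≤ σ₀ := le_csSup hSbdd hρS
  have hσ₀1 : σ₀ ≤ 1 := hσ₀S.1.2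
  have hζσ₀ : riemannZeta (σ₀ + t₀ * I) = 0 := hσ₀S.2
  have hσ₀1' : σ₀ < 1 := by
    rcases hσ₀1.lt_or_eq with h | h
    · exact h
    · exfalso
      refine riemannZeta_ne_zero_of_one_le_re (s := σ₀ + t₀ * I) ?_ hζσ₀
      simp [h]
  refine ⟨σ₀ + t₀ * I - 1, ?_, ?_, ?_, ?_⟩
  · rw [zetaOne_eq_zero_iff]
    refine ⟨?_, by rwa [add_sub_cancel]⟩
    intro h; have := congrArg Complex.im h; simp at this; exact hρim this
  · simp; linarith
  · simp; linarith
  · intro t ht hzero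
    rw [zetaOne_eq_zero_iff] at hzero
    obtain ⟨-, hζ⟩ := hzero
    have heq : 1 + (↑σ₀ + ↑t₀ * I - 1 + ↑t) = ((σ₀ + t : ℝ) : ℂ) + t₀ * I := by push_cast; ring
    rw [heq] at hζ
    by_cases hle : σ₀ + t ≤ 1
    · have hmem : σ₀ + t ∈ S := ⟨⟨by linarith, hle⟩, hζ⟩
      have := le_csSup hSbdd hmem
      linarith
    · exact riemannZeta_ne_zero_of_one_le_re (s := ((σ₀ + t : ℝ) : ℂ) + t₀ * I)
        (by simp; linarith) hζ

/-! ### Landau's theorem for `-g₁`: the case `g ≤ 0` eventually -/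

/-- `mellinIoi (-g) = -mellinIoi g`. [folklore] -/
theorem mellinIoi_neg (g : ℝ → ℝ) (s : ℂ) :
    mellinIoi (fun x ↦ -g x) s = -mellinIoi g s := by
  unfold mellinIoi
  rw [← integral_neg]
  refine integral_congr_ae (Filter.Eventually.of_forall fun x ↦ ?_)
  push_cast
  ring

/-- **Landau's theorem applied to `-g₁`**: if `g ≤ 0` on `(X₁, ∞)` then
`∫_1^∞ |g(x)| log x · x^{-σ-1} dx < ∞` for every `σ > -b` (same proof as
`integrableOn_nicolasFnLog_of_nonneg`, with `Φ₁` replaced by `-Φ₁`).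
[cite: Nicolas1983, §4, proof of Prop. 3 ("On procède de même avec `J(x) + x^{-b}`")] -/
theorem integrableOn_nicolasFnLog_of_nonpos {b c : ℝ} (hb0 : 0 < b) (hb : b < 1 / 2) {X₁ : ℝ}
    (hX₁ : 1 ≤ X₁) (hnonpos : ∀ x, X₁ < x → nicolasFn b c x ≤ 0) {σ : ℝ} (hσ : -b < σ) :
    IntegrableOn (fun x ↦ nicolasFnLog b c x * x ^ (-(σ + 1))) (Ioi 1) := by
  obtain ⟨W₀, hW₀o, hW₀c, hW₀r, hW₀sub⟩ := exists_convex_nhd_segment hb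
  have hmeas : Measurable (fun x ↦ -nicolasFnLog b c x) := (measurable_nicolasFnLog b c).neg
  have hint1 : IntegrableOn (fun x ↦ -nicolasFnLog b c x * x ^ (-((1 : ℝ) + 1))) (Ioi 1) := by
    refine ((integrableOn_nicolasFnLog_rpow (c := c) hb0 one_pos).neg).congr_fun
      (fun x _ ↦ ?_) measurableSet_Ioi
    simp only [Pi.neg_apply, neg_mul]
  have key := integrableOn_of_differentiableOn_union_convex hmeas (σ₁ := 1)
    (a := -b) (X₁ := X₁) hint1 hX₁ (fun x hx ↦ ?_)
    (by linarith) hW₀o hW₀c (fun σ' h1 h2 ↦ hW₀r σ' h1 (by linarith))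
    (Φ := fun s ↦ -nicolasCont b c s) ?_ ?_ hσ
  · refine (key.neg).congr_fun (fun x _ ↦ ?_) measurableSet_Ioi
    simp only [Pi.neg_apply, neg_mul, neg_neg]
  · have h1 : nicolasFn b c x ≤ 0 := hnonpos x hx
    have h2 : 0 ≤ Real.log x := Real.log_nonneg (by linarith)
    show 0 ≤ -(nicolasFn b c x * Real.log x)
    nlinarith
  · refine ((differentiableOn_nicolasCont b c).mono ?_).neg
    rintro s (hs | hs)
    · have hs' : 1 < s.re := hs
      refine ⟨mem_nicolasDom_of_one_lt_re hs', fun h ↦ ?_⟩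
      rw [Set.mem_singleton_iff] at h
      rw [h] at hs'
      simp at hs'
      linarith
    · exact hW₀sub hs
  · intro s hs
    show -nicolasCont b c s = mellinIoi (fun x ↦ -nicolasFnLog b c x) s
    rw [mellinIoi_neg, mellinIoi_nicolasFnLog hb0 hs]

/-- Consequently, if `g ≤ 0` eventually then `F₁` is holomorphic on the half-plane `Re s > -b`.
[cite: Nicolas1983, §4, proof of Prop. 3] -/
theorem differentiableOn_mellinIoi_nicolasFnLog_of_nonpos {b c : ℝ} (hb0 : 0 < b)
    (hb : b < 1 / 2) {X₁ : ℝ} (hX₁ : 1 ≤ X₁) (hnonpos : ∀ x, X₁ < x → nicolasFn b c x ≤ 0) :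
    DifferentiableOn ℂ (mellinIoi (nicolasFnLog b c)) {s : ℂ | -b < s.re} :=
  differentiableOn_mellinIoi_of_forall (measurable_nicolasFnLog b c) fun _ hσ ↦
    integrableOn_nicolasFnLog_of_nonpos hb0 hb hX₁ hnonpos hσ

/-! ### The `Ω`-theorem -/

/-- **`g` is negative for arbitrarily large `x`**, for every `b ∈ (0, 1/2)` and zero `s₀` of `Z₁`
with `Re s₀ > -b` that is right-most on its horizontal line, and every real `c`.
[cite: Nicolas1983, §4 Prop. 3] -/
theorem exists_nicolasFn_neg_of_zero {b : ℝ} (hb0 : 0 < b) (hb : b < 1 / 2) {s₀ : ℂ}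
    (hZ : zetaOne s₀ = 0) (hre : -b < s₀.re) (hray : ∀ t : ℝ, 0 < t → zetaOne (s₀ + t) ≠ 0)
    (c X : ℝ) : ∃ x : ℝ, X < x ∧ nicolasFn b c x < 0 := by
  by_contra hcon
  push Not at hcon
  have hF := differentiableOn_mellinIoi_nicolasFnLog_of_nonneg (b := b)
    (c := c) hb0 hb (X₁ := max X 1) (le_max_right _ _)
    (fun x hx ↦ hcon x (lt_of_le_of_lt (le_max_left _ _) hx))
  exact false_of_zetaOne_zero hb0 hb hZ hre hray hF

/-- **`g` is positive for arbitrarily large `x`**, for every `b ∈ (0, 1/2)` and zero `s₀` of `Z₁`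
with `Re s₀ > -b` that is right-most on its horizontal line, and every real `c` (Landau's theorem
applied to `-g₁`). [cite: Nicolas1983, §4 Prop. 3] -/
theorem exists_nicolasFn_pos_of_zero {b : ℝ} (hb0 : 0 < b) (hb : b < 1 / 2) {s₀ : ℂ}
    (hZ : zetaOne s₀ = 0) (hre : -b < s₀.re) (hray : ∀ t : ℝ, 0 < t → zetaOne (s₀ + t) ≠ 0)
    (c X : ℝ) : ∃ x : ℝ, X < x ∧ 0 < nicolasFn b c x := by
  by_contra hcon
  push Not at hcon
  have hF := differentiableOn_mellinIoi_nicolasFnLog_of_nonpos (b := b)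
    (c := c) hb0 hb (X₁ := max X 1) (le_max_right _ _)
    (fun x hx ↦ hcon x (lt_of_le_of_lt (le_max_left _ _) hx))
  exact false_of_zetaOne_zero hb0 hb hZ hre hray hF

/-- **Nicolas's `Ω`-theorem (the analytic heart of Robin 1984, §4 Prop. 1).** If the Riemann
hypothesis is false then there is `b ∈ (0, 1/2)` such that for every real `c` and every `X` there
is `x > X` with `g(x) = c x^{-b} + γ + log log x + E(x) - A(x) < 0`, i.e.
`A(x) - γ - log log x - E(x) > c x^{-b}` for arbitrarily large `x`.
[cite: Nicolas1983, Thm. 3 (c) and §4 Prop. 3] [cite: Robin1984, §4 Prop. 1] -/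
theorem exists_nicolasFn_neg (hRH : ¬ RiemannHypothesis) :
    ∃ b : ℝ, 0 < b ∧ b < 1 / 2 ∧ ∀ c X : ℝ, ∃ x : ℝ, X < x ∧ nicolasFn b c x < 0 := by
  obtain ⟨s₀, hZ, hre1, hre2, hray⟩ := exists_zero_right_of_not_RH hRH
  exact ⟨(-s₀.re + 1 / 2) / 2, by linarith, by linarith, fun c X ↦
    exists_nicolasFn_neg_of_zero (by linarith) (by linarith) hZ (by linarith) hray c X⟩

/-- **Nicolas's `Ω±`-theorem for the comparison function `g`.** If the Riemann hypothesis is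
false then there is `b ∈ (0, 1/2)` such that for every real `c`, both `g(x) < 0` and `g(x) > 0`
happen for arbitrarily large `x` (`g = nicolasFn b c`), i.e.
`A(x) - γ - log log x - E(x) = Ω±(x^{-b})` with every constant.
[cite: Nicolas1983, Thm. 3 (c) and §4 Prop. 3 (`J(x) = Ω±(x^{-b})`, `1 - θ < b < 1/2`)] -/
theorem exists_nicolasFn_neg_and_pos (hRH : ¬ RiemannHypothesis) :
    ∃ b : ℝ, 0 < b ∧ b < 1 / 2 ∧ (∀ c X : ℝ, ∃ x : ℝ, X < x ∧ nicolasFn b c x < 0) ∧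
      (∀ c X : ℝ, ∃ x : ℝ, X < x ∧ 0 < nicolasFn b c x) := by
  obtain ⟨s₀, hZ, hre1, hre2, hray⟩ := exists_zero_right_of_not_RH hRH
  exact ⟨(-s₀.re + 1 / 2) / 2, by linarith, by linarith,
    fun c X ↦ exists_nicolasFn_neg_of_zero (by linarith) (by linarith) hZ (by linarith) hray c X,
    fun c X ↦ exists_nicolasFn_pos_of_zero (by linarith) (by linarith) hZ (by linarith) hray c X⟩

end Nicolas

end Literature.NumberTheory.LFunctions

end

/-! ## Part II. Transfer to `σ(n)` (Robin 1984, §4 Prop. 1) -/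

noncomputable section

open Filter Topology Set Finset ArithmeticFunction

namespace Literature.NumberTheory.LFunctions

namespace Nicolas

/-! ### `σ(N)/N` for `N = lcm(1, …, n)` -/

/-- `σ(lcm(1..n)) = ∏_{p ≤ n} σ(p^{k_p})`, `k_p = ⌊log n/log p⌋` (multiplicativity). [folklore] -/
theorem sigma_lcmUpto (n : ℕ) :
    sigma 1 (Nat.lcmUpto n) = ∏ p ∈ Nat.primesLE n, sigma 1 (p ^ Nat.log p n) := by
  have hN : Nat.lcmUpto n ≠ 0 := Nat.lcmUpto_ne_zero n
  rw [isMultiplicative_sigma.multiplicative_factorization _ hN, Finsupp.prod,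
    Nat.support_factorization, Nat.primeFactors_lcmUpto]
  refine Finset.prod_congr rfl fun p hp ↦ ?_
  rw [Nat.factorization_lcmUpto n (Nat.mem_primesLE.1 hp).2]

/-- `σ(p^k)/p^k = (1 - p^{-k-1})/(1 - p^{-1})`. [folklore] -/
theorem sigma_prime_pow_div {p : ℕ} (k : ℕ) (hp : p.Prime) :
    ((sigma 1 (p ^ k) : ℕ) : ℝ) / (p : ℝ) ^ k =
      (1 - ((p : ℝ) ^ (k + 1))⁻¹) / (1 - (p : ℝ)⁻¹) := by
  rw [sigma_apply_prime_pow hp]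
  simp only [mul_one]
  push_cast
  have hp1' : (p : ℝ) ≠ 1 := by exact_mod_cast hp.one_lt.ne'
  rw [geom_sum_eq hp1' (k + 1)]
  have hp0 : (p : ℝ) ≠ 0 := by exact_mod_cast hp.ne_zero
  have hp1 : (p : ℝ) - 1 ≠ 0 := sub_ne_zero.2 hp1'
  have hp2 : 1 - (p : ℝ)⁻¹ ≠ 0 := by
    rw [sub_ne_zero, ne_comm, Ne, inv_eq_one]
    exact hp1'
  field_simp
  ring

/-- `σ(N)/N = ∏_{p ≤ n} (1 - p^{-k_p-1})/(1 - 1/p)` for `N = lcm(1..n)`. [folklore] -/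
theorem sigma_lcmUpto_div (n : ℕ) :
    ((sigma 1 (Nat.lcmUpto n) : ℕ) : ℝ) / (Nat.lcmUpto n : ℝ) =
      ∏ p ∈ Nat.primesLE n, (1 - ((p : ℝ) ^ (Nat.log p n + 1))⁻¹) / (1 - (p : ℝ)⁻¹) := by
  rw [sigma_lcmUpto, Nat.lcmUpto_eq_prod_pow_log]
  push_cast
  rw [← Finset.prod_div_distrib]
  exact Finset.prod_congr rfl fun p hp ↦ sigma_prime_pow_div _ (Nat.mem_primesLE.1 hp).2

/-- `σ(N)/N = e^{A(n)} ∏_{p ≤ n} (1 - p^{-k_p-1})` for `N = lcm(1..n)` (Mertens' product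
`e^{A(n)} = ∏_{p ≤ n} (1 - 1/p)⁻¹`). [folklore] -/
theorem sigma_lcmUpto_div_eq_exp_mul (n : ℕ) :
    ((sigma 1 (Nat.lcmUpto n) : ℕ) : ℝ) / (Nat.lcmUpto n : ℝ) =
      Real.exp (mertensLog n) * ∏ p ∈ Nat.primesLE n, (1 - ((p : ℝ) ^ (Nat.log p n + 1))⁻¹) := by
  rw [sigma_lcmUpto_div, exp_mertensLog_natCast, ← Finset.prod_mul_distrib]
  refine Finset.prod_congr rfl fun p _ ↦ ?_
  rw [div_eq_mul_inv, mul_comm]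

/-- `e^{-2t} ≤ 1 - t` for `0 ≤ t ≤ 1/2`. [folklore] -/
theorem exp_neg_two_mul_le {t : ℝ} (ht0 : 0 ≤ t) (ht : t ≤ 1 / 2) :
    Real.exp (-(2 * t)) ≤ 1 - t := by
  have h1 : 2 * t + 1 ≤ Real.exp (2 * t) := Real.add_one_le_exp _
  have h2 : 0 < Real.exp (2 * t) := Real.exp_pos _
  rw [Real.exp_neg]
  rw [inv_le_iff_one_le_mul₀ h2]
  nlinarith [mul_nonneg ht0 (show 0 ≤ 1 - 2 * t by linarith)]

/-- The correction factor is close to `1`: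
`∏_{p ≤ n} (1 - p^{-k_p-1}) ≥ exp(-2 A(n)/√(n+1))`, because `p^{k_p+1} ≥ max(n+1, p²) ≥ p √(n+1)`
so that `p^{-k_p-1} ≤ (1/p)/√(n+1) ≤ a_p/√(n+1)`, and `1 - t ≥ e^{-2t}`. [folklore] -/
theorem exp_le_prod_one_sub_inv_pow_log (n : ℕ) :
    Real.exp (-(2 * (mertensLog n / Real.sqrt (n + 1)))) ≤
      ∏ p ∈ Nat.primesLE n, (1 - ((p : ℝ) ^ (Nat.log p n + 1))⁻¹) := by
  rw [mertensLog_natCast, Finset.sum_div, Finset.mul_sum, ← Finset.sum_neg_distrib, Real.exp_sum]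
  refine Finset.prod_le_prod (fun p _ ↦ (Real.exp_pos _).le) fun p hp ↦ ?_
  obtain ⟨hpn, hp⟩ := Nat.mem_primesLE.1 hp
  set k := Nat.log p n with hk
  have hs : 0 < Real.sqrt (n + 1) := Real.sqrt_pos.2 (by positivity)
  have hp0 : (0 : ℝ) < p := by exact_mod_cast hp.pos
  have hk1 : k ≠ 0 := (Nat.log_pos hp.one_lt hpn).ne'
  -- `n + 1 ≤ p^k · p^k`
  have hA : n + 1 ≤ p ^ k * p := by
    have := Nat.lt_pow_succ_log_self hp.one_lt n
    rw [pow_succ] at this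
    exact this
  have hB : p ≤ p ^ k := Nat.le_self_pow hk1 p
  have hC : n + 1 ≤ p ^ k * p ^ k := hA.trans (Nat.mul_le_mul_left _ hB)
  have hC' : ((n : ℝ) + 1) ≤ ((p : ℝ) ^ k) ^ 2 := by rw [sq]; exact_mod_cast hC
  have hsqrt : Real.sqrt (n + 1) ≤ (p : ℝ) ^ k := by
    calc Real.sqrt (n + 1) ≤ Real.sqrt (((p : ℝ) ^ k) ^ 2) := Real.sqrt_le_sqrt hC'
      _ = (p : ℝ) ^ k := Real.sqrt_sq (by positivity)
  -- `t = p^{-(k+1)} ≤ a_p / √(n+1)` and `t ≤ 1/2`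
  set t : ℝ := ((p : ℝ) ^ (k + 1))⁻¹ with ht
  have ht0 : 0 ≤ t := by positivity
  have hpk : (4 : ℝ) ≤ (p : ℝ) ^ (k + 1) := by
    have h2 : (2 : ℝ) ≤ p := by exact_mod_cast hp.two_le
    have hk2 : 2 ≤ k + 1 := by omega
    calc (4 : ℝ) = 2 ^ 2 := by norm_num
      _ ≤ (p : ℝ) ^ 2 := by gcongr
      _ ≤ (p : ℝ) ^ (k + 1) := pow_le_pow_right₀ (by linarith) hk2
  have ht2 : t ≤ 1 / 2 := by
    rw [ht]
    have : ((p : ℝ) ^ (k + 1))⁻¹ ≤ (4 : ℝ)⁻¹ := inv_anti₀ (by norm_num) hpk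
    linarith [show (4 : ℝ)⁻¹ ≤ 1 / 2 by norm_num]
  have hta : t ≤ -Real.log (1 - (p : ℝ)⁻¹) / Real.sqrt (n + 1) := by
    have h1 : t ≤ ((p : ℝ) * Real.sqrt (n + 1))⁻¹ := by
      rw [ht]
      refine inv_anti₀ (mul_pos hp0 hs) ?_
      rw [pow_succ, mul_comm]
      exact mul_le_mul_of_nonneg_right hsqrt hp0.le
    have h2 : ((p : ℝ) * Real.sqrt (n + 1))⁻¹ = (p : ℝ)⁻¹ / Real.sqrt (n + 1) := by
      rw [mul_inv, div_eq_mul_inv]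
    have h3 : (p : ℝ)⁻¹ ≤ -Real.log (1 - (p : ℝ)⁻¹) := by
      have := inv_le_primeLogCoeff hp
      rwa [primeLogCoeff_of_prime hp] at this
    calc t ≤ (p : ℝ)⁻¹ / Real.sqrt (n + 1) := by rw [← h2]; exact h1
      _ ≤ -Real.log (1 - (p : ℝ)⁻¹) / Real.sqrt (n + 1) :=
          div_le_div_of_nonneg_right h3 hs.le
  calc Real.exp (-(2 * (-Real.log (1 - (p : ℝ)⁻¹) / Real.sqrt (n + 1))))
      ≤ Real.exp (-(2 * t)) := Real.exp_le_exp.2 (by linarith)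
    _ ≤ 1 - t := exp_neg_two_mul_le ht0 ht2

/-- **`log σ(N) - log N ≥ A(n) - 4 (1 + log n)/√(n+1)`** for `N = lcm(1, …, n)`, `n ≥ 1`
(`lcm(1, …, n)` plays the part of Robin's colossally abundant numbers). [folklore] -/
theorem log_sigma_lcmUpto_sub_log_ge {n : ℕ} (hn : 1 ≤ n) :
    mertensLog n - 4 * (1 + Real.log n) / Real.sqrt (n + 1) ≤
      Real.log (sigma 1 (Nat.lcmUpto n) : ℝ) - Real.log (Nat.lcmUpto n : ℝ) := by
  have hN : (0 : ℝ) < Nat.lcmUpto n := by exact_mod_cast Nat.lcmUpto_pos n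
  have hprod := exp_le_prod_one_sub_inv_pow_log n
  have hpos : 0 < ∏ p ∈ Nat.primesLE n, (1 - ((p : ℝ) ^ (Nat.log p n + 1))⁻¹) :=
    lt_of_lt_of_le (Real.exp_pos _) hprod
  have hid := sigma_lcmUpto_div_eq_exp_mul n
  have hq : 0 < ((sigma 1 (Nat.lcmUpto n) : ℕ) : ℝ) / (Nat.lcmUpto n : ℝ) := by
    rw [hid]; exact mul_pos (Real.exp_pos _) hpos
  have hσ : 0 < ((sigma 1 (Nat.lcmUpto n) : ℕ) : ℝ) := by
    have := mul_pos hq hN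
    rwa [div_mul_cancel₀ _ hN.ne'] at this
  rw [← Real.log_div hσ.ne' hN.ne', hid, Real.log_mul (Real.exp_pos _).ne' hpos.ne', Real.log_exp]
  have hlog : -(2 * (mertensLog n / Real.sqrt (n + 1))) ≤
      Real.log (∏ p ∈ Nat.primesLE n, (1 - ((p : ℝ) ^ (Nat.log p n + 1))⁻¹)) := by
    rw [← Real.log_exp (-(2 * _))]
    exact Real.log_le_log (Real.exp_pos _) hprod
  have hA : mertensLog n ≤ 2 * (1 + Real.log n) := mertensLog_le (by exact_mod_cast hn)
  have hs : 0 < Real.sqrt (n + 1) := Real.sqrt_pos.2 (by positivity)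
  have h2 : 2 * (mertensLog n / Real.sqrt (n + 1)) ≤ 4 * (1 + Real.log n) / Real.sqrt (n + 1) := by
    rw [← mul_div_assoc, div_le_div_iff_of_pos_right hs]
    linarith
  linarith

/-! ### Elementary bounds on `ψ` -/

/-- `ψ(x) ≥ x/4` for `x ≥ 7` (from Mathlib's `ψ(x) ≥ (x-1) log 2 - log(x+2)` and
`log(x+2) ≤ (x+2)/16 + log 16 - 1`). [folklore] -/
theorem psi_ge_quarter {x : ℝ} (hx : 7 ≤ x) : x / 4 ≤ Chebyshev.psi x := by
  have h1 := Chebyshev.psi_ge' (x := x) (by linarith)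
  have hl2 := Real.log_two_gt_d9
  have hl2' := Real.log_two_lt_d9
  have h16 : Real.log (x + 2) ≤ (x + 2) / 16 + Real.log 16 - 1 := by
    have := Real.log_le_sub_one_of_pos (show 0 < (x + 2) / 16 by linarith)
    rw [Real.log_div (by linarith) (by norm_num)] at this
    linarith
  have h16' : Real.log 16 = 4 * Real.log 2 := by
    rw [show (16 : ℝ) = 2 ^ 4 by norm_num, Real.log_pow]
    norm_num
  have h3 : 0.6931471803 * (x - 1) ≤ (x - 1) * Real.log 2 := by
    rw [mul_comm]
    exact mul_le_mul_of_nonneg_left hl2.le (by linarith)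
  linarith

/-- **`log log ψ(x) ≤ log log x + E(x)`** for `x ≥ 7`, `E(x) = (ψ(x) - x)/(x log x)`
(two applications of `log y ≤ log x + (y - x)/x`). [folklore] -/
theorem log_log_psi_le {x : ℝ} (hx : 7 ≤ x) :
    Real.log (Real.log (Chebyshev.psi x)) ≤ Real.log (Real.log x) + psiError x := by
  have hψ := psi_ge_quarter hx
  have hx0 : 0 < x := by linarith
  have hψ0 : 0 < Chebyshev.psi x := by linarith
  have hlogx : 0 < Real.log x := Real.log_pos (by linarith)
  have h1 : Real.log (Chebyshev.psi x) ≤ Real.log x + (Chebyshev.psi x - x) / x := by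
    have := Real.log_le_sub_one_of_pos (div_pos hψ0 hx0)
    rw [Real.log_div hψ0.ne' hx0.ne'] at this
    have h : (Chebyshev.psi x - x) / x = Chebyshev.psi x / x - 1 := by field_simp
    linarith
  have hw : 0 < Real.log (Chebyshev.psi x) := Real.log_pos (by linarith)
  have h2 : Real.log (Real.log (Chebyshev.psi x)) ≤
      Real.log (Real.log x) + (Real.log (Chebyshev.psi x) - Real.log x) / Real.log x := by
    have := Real.log_le_sub_one_of_pos (div_pos hw hlogx)
    rw [Real.log_div hw.ne' hlogx.ne'] at this
    have h : (Real.log (Chebyshev.psi x) - Real.log x) / Real.log x =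
        Real.log (Chebyshev.psi x) / Real.log x - 1 := by field_simp
    linarith
  have h3 : (Real.log (Chebyshev.psi x) - Real.log x) / Real.log x ≤
      ((Chebyshev.psi x - x) / x) / Real.log x :=
    div_le_div_of_nonneg_right (by linarith) hlogx.le
  rw [psiError_of_two_le (by linarith), ← div_div]
  linarith

/-! ### The transfer -/

/-- **The transfer inequality.** Let `0 < b < 1/2`, `x ≥ 7`, `n = ⌊x⌋`, `N = lcm(1, …, n)` and
suppose Robin's inequality with the correction term holds *strictly the wrong way* at `N`:
`σ(N) < e^γ N log log N + N log log N/(log N)^b`. Then Nicolas's function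
`g = nicolasFn b c₀`, `c₀ = 6 + 4/(1/2 - b)`, is positive at `x`. (The transfer step of Robin's
proof of §4 Prop. 1, with `lcm(1, …, n)` in place of colossally abundant numbers.)
[cite: Robin1984, §4, proof of Prop. 1] -/
theorem nicolasFn_pos_of_sigma_lt {b : ℝ} (hb0 : 0 < b) (hb : b < 1 / 2) {x : ℝ} (hx : 7 ≤ x)
    (hσ : ((sigma 1 (Nat.lcmUpto ⌊x⌋₊) : ℕ) : ℝ) <
      Real.exp Real.eulerMascheroniConstant * (Nat.lcmUpto ⌊x⌋₊ : ℝ) *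
          Real.log (Real.log (Nat.lcmUpto ⌊x⌋₊ : ℝ)) +
        1 * (Nat.lcmUpto ⌊x⌋₊ : ℝ) * Real.log (Real.log (Nat.lcmUpto ⌊x⌋₊ : ℝ)) /
          Real.log (Nat.lcmUpto ⌊x⌋₊ : ℝ) ^ b) :
    0 < nicolasFn b (6 + 4 / (1 / 2 - b)) x := by
  set n : ℕ := ⌊x⌋₊ with hn
  set N : ℕ := Nat.lcmUpto n with hNdef
  set γ : ℝ := Real.eulerMascheroniConstant with hγ
  set ε : ℝ := 1 / 2 - b with hε
  have hε0 : 0 < ε := by rw [hε]; linarith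
  have hx0 : 0 < x := by linarith
  have hx1 : 1 ≤ x := by linarith
  have hn1 : 1 ≤ n := Nat.le_floor (by simpa using hx1)
  have hn7 : 7 ≤ n := Nat.le_floor (by simpa using hx)
  have hnx : (n : ℝ) ≤ x := Nat.floor_le hx0.le
  have hxn : x < n + 1 := Nat.lt_floor_add_one x
  have hn0 : (0 : ℝ) < n := by exact_mod_cast hn1
  have hN : (0 : ℝ) < N := by exact_mod_cast Nat.lcmUpto_pos n
  -- `log N = ψ(x) ≥ x/4`
  have hlogN : Real.log (N : ℝ) = Chebyshev.psi x := by
    rw [hNdef, ← Chebyshev.psi_eq_log_lcmUpto, hn, ← Chebyshev.psi_eq_psi_coe_floor]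
  have hψ : x / 4 ≤ Chebyshev.psi x := psi_ge_quarter hx
  have hL1 : 1 < Real.log (N : ℝ) := by rw [hlogN]; linarith
  have hL0 : 0 < Real.log (N : ℝ) := by linarith
  have hLL0 : 0 < Real.log (Real.log (N : ℝ)) := Real.log_pos hL1
  -- the lower bound `A(x) - 4(1 + log x)/√x ≤ log σ(N) - log N`
  have hlow := log_sigma_lcmUpto_sub_log_ge hn1
  have hAx : mertensLog x = mertensLog n := by rw [mertensLog_eq_natCast_floor x]
  have hcorr : 4 * (1 + Real.log n) / Real.sqrt (n + 1) ≤ 4 * (1 + Real.log x) / Real.sqrt x := by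
    have hsx : 0 < Real.sqrt x := Real.sqrt_pos.2 hx0
    have h1 : Real.log n ≤ Real.log x := Real.log_le_log hn0 hnx
    have h2 : Real.sqrt x ≤ Real.sqrt (n + 1) := Real.sqrt_le_sqrt hxn.le
    have h3 : 0 ≤ 1 + Real.log x := by linarith [Real.log_nonneg hx1]
    have h4 : 0 ≤ 1 + Real.log (n : ℝ) := by
      linarith [Real.log_nonneg (show (1:ℝ) ≤ n by exact_mod_cast hn1)]
    calc 4 * (1 + Real.log n) / Real.sqrt (n + 1) ≤ 4 * (1 + Real.log x) / Real.sqrt (n + 1) := by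
          gcongr
      _ ≤ 4 * (1 + Real.log x) / Real.sqrt x := by
          gcongr
  -- `(1 + log x)/√x ≤ (1 + 1/ε) x^{-b}`
  have hcorr2 : 4 * (1 + Real.log x) / Real.sqrt x ≤ 4 * (1 + 1 / ε) * x ^ (-b) := by
    have h1 : Real.log x ≤ x ^ ε / ε := Real.log_le_rpow_div hx0.le hε0
    have h2 : 1 ≤ x ^ ε := Real.one_le_rpow hx1 hε0.le
    have h3 : 1 + Real.log x ≤ (1 + 1 / ε) * x ^ ε := by
      rw [add_mul, one_mul, one_div, inv_mul_eq_div]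
      linarith
    have hsx : Real.sqrt x = x ^ (1 / 2 : ℝ) := Real.sqrt_eq_rpow x
    have h4 : x ^ ε / Real.sqrt x = x ^ (-b) := by
      rw [hsx, ← Real.rpow_sub hx0]
      congr 1
      rw [hε]; ring
    have hsx0 : 0 < Real.sqrt x := Real.sqrt_pos.2 hx0
    calc 4 * (1 + Real.log x) / Real.sqrt x ≤ 4 * ((1 + 1 / ε) * x ^ ε) / Real.sqrt x := by
          gcongr
      _ = 4 * (1 + 1 / ε) * (x ^ ε / Real.sqrt x) := by ring
      _ = 4 * (1 + 1 / ε) * x ^ (-b) := by rw [h4]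
  -- the upper bound from `hσ`: `log σ(N) - log N < γ + log log log N... `
  -- write the right-hand side of `hσ` as `N · loglog N · (e^γ + (log N)^{-b})`
  set L : ℝ := Real.log (N : ℝ) with hL
  set LL : ℝ := Real.log L with hLLdef
  have hσ' : ((sigma 1 N : ℕ) : ℝ) < (N : ℝ) * LL * (Real.exp γ + L ^ (-b)) := by
    have h : Real.exp γ * (N : ℝ) * LL + 1 * (N : ℝ) * LL / L ^ b =
        (N : ℝ) * LL * (Real.exp γ + L ^ (-b)) := by
      rw [Real.rpow_neg hL0.le]
      ring
    rw [← h]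
    exact hσ
  have hσpos : (0 : ℝ) < (sigma 1 N : ℕ) := by
    have h1 : 0 < sigma 1 N := by
      rw [ArithmeticFunction.sigma_pos_iff]
      exact Nat.lcmUpto_pos n
    exact_mod_cast h1
  have hR0 : 0 < Real.exp γ + L ^ (-b) := by positivity
  have hup : Real.log ((sigma 1 N : ℕ) : ℝ) - Real.log (N : ℝ) <
      γ + Real.log LL + L ^ (-b) := by
    have h1 := Real.log_lt_log hσpos hσ'
    rw [Real.log_mul (mul_pos hN hLL0).ne' hR0.ne', Real.log_mul hN.ne' hLL0.ne'] at h1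
    -- `log (e^γ + y) ≤ γ + y` for `y ≥ 0`
    have hy : 0 ≤ L ^ (-b) := Real.rpow_nonneg hL0.le _
    have h2 : Real.log (Real.exp γ + L ^ (-b)) ≤ γ + L ^ (-b) := by
      have hγ0 : 0 ≤ γ := by
        rw [hγ]; linarith [Real.one_half_lt_eulerMascheroniConstant]
      have h3 : Real.exp γ + L ^ (-b) ≤ Real.exp γ * (1 + L ^ (-b)) := by
        rw [mul_add, mul_one]
        have : L ^ (-b) ≤ Real.exp γ * L ^ (-b) := by
          have h1e : 1 ≤ Real.exp γ := Real.one_le_exp hγ0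
          nlinarith
        linarith
      calc Real.log (Real.exp γ + L ^ (-b)) ≤ Real.log (Real.exp γ * (1 + L ^ (-b))) :=
            Real.log_le_log hR0 h3
        _ = γ + Real.log (1 + L ^ (-b)) := by
            rw [Real.log_mul (Real.exp_pos _).ne' (by positivity), Real.log_exp]
        _ ≤ γ + L ^ (-b) := by
            have := Real.log_le_sub_one_of_pos (show 0 < 1 + L ^ (-b) by positivity)
            linarith
    linarith
  -- `log LL ≤ log log x + E(x)` and `L^{-b} ≤ 2 x^{-b}`
  have hLL : Real.log LL ≤ Real.log (Real.log x) + psiError x := by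
    rw [hLLdef, hlogN]
    exact log_log_psi_le hx
  have hLb : L ^ (-b) ≤ 2 * x ^ (-b) := by
    rw [hlogN]
    have h1 : Chebyshev.psi x ^ (-b) ≤ (x / 4) ^ (-b) :=
      Real.rpow_le_rpow_of_nonpos (by linarith) hψ (by linarith)
    have h2 : (x / 4) ^ (-b) = 4 ^ b * x ^ (-b) := by
      rw [Real.div_rpow hx0.le (by norm_num), Real.rpow_neg (by norm_num : (0:ℝ) ≤ 4),
        div_eq_mul_inv, inv_inv, mul_comm]
    have h3 : (4 : ℝ) ^ b ≤ 2 := by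
      calc (4 : ℝ) ^ b ≤ 4 ^ (1 / 2 : ℝ) := Real.rpow_le_rpow_of_exponent_le (by norm_num) hb.le
        _ = 2 := by
            rw [show (4 : ℝ) = 2 ^ (2 : ℝ) by norm_num, ← Real.rpow_mul (by norm_num)]
            norm_num
    have h4 : 0 ≤ x ^ (-b) := Real.rpow_nonneg hx0.le _
    calc Chebyshev.psi x ^ (-b) ≤ (x / 4) ^ (-b) := h1
      _ = 4 ^ b * x ^ (-b) := h2
      _ ≤ 2 * x ^ (-b) := by gcongr
  -- assemble
  have hfin : mertensLog x - γ - Real.log (Real.log x) - psiError x <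
      (6 + 4 / (1 / 2 - b)) * x ^ (-b) := by
    have h4 : 0 ≤ x ^ (-b) := Real.rpow_nonneg hx0.le _
    have : (6 + 4 / (1 / 2 - b)) * x ^ (-b) = 2 * x ^ (-b) + 4 * (1 + 1 / ε) * x ^ (-b) := by
      rw [hε]; ring
    rw [this]
    linarith
  unfold nicolasFn
  linarith

end Nicolas

section RH

open Nicolas

/-- **DISCHARGE of the named fact `Robin1984_sigma_oscillation`** (Robin 1984, §4 Prop. 1 =
Lagarias 2002, Prop. 3.2): if the Riemann hypothesis is false then, with `β = b ∈ (0, 1/2)` from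
Nicolas's `Ω`-theorem (`exists_nicolasFn_neg`) and `C = 1`,
`σ(n) ≥ e^γ n log log n + C n log log n/(log n)^β` for infinitely many `n`, namely for
`n = lcm(1, …, ⌊x⌋)` whenever Nicolas's function `g = nicolasFn b c₀` is negative at `x`
(`nicolasFn_pos_of_sigma_lt`). [cite: Robin1984, §4 Prop. 1] [cite: Lagarias2002, Prop. 3.2] -/
theorem Robin1984_sigma_oscillation_holds : Robin1984_sigma_oscillation := by
  intro hRH
  obtain ⟨b, hb0, hb, hneg⟩ := exists_nicolasFn_neg hRH
  refine ⟨b, 1, hb0, hb, one_pos, ?_⟩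
  rw [Filter.frequently_atTop]
  intro N₀
  obtain ⟨x, hxX, hgx⟩ := hneg (6 + 4 / (1 / 2 - b)) (max ((N₀ : ℝ) + 1) 7)
  have hx7 : 7 ≤ x := le_trans (le_max_right _ _) hxX.le
  have hxN : (N₀ : ℝ) + 1 ≤ x := le_trans (le_max_left _ _) hxX.le
  refine ⟨Nat.lcmUpto ⌊x⌋₊, ?_, ?_⟩
  · have h1 : N₀ ≤ ⌊x⌋₊ := by
      refine Nat.le_floor ?_
      linarith
    have h2 : ⌊x⌋₊ ≤ Nat.lcmUpto ⌊x⌋₊ := by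
      refine Nat.le_of_dvd (Nat.lcmUpto_pos _) ?_
      have hmem : ⌊x⌋₊ ∈ Finset.Icc 1 ⌊x⌋₊ :=
        Finset.mem_Icc.2 ⟨Nat.le_floor (by push_cast; linarith), le_rfl⟩
      show ⌊x⌋₊ ∣ (Finset.Icc 1 ⌊x⌋₊).lcm id
      exact Finset.dvd_lcm hmem
    exact h1.trans h2
  · by_contra hlt
    push Not at hlt
    have := nicolasFn_pos_of_sigma_lt hb0 hb hx7 hlt
    linarith

/-! ### Unconditional corollaries: the "hard" directions of Robin's and Lagarias's criteria -/

/-- **Robin's inequality for all `n > 5040` implies RH** (Robin 1984, Thm. 2 direction "⇐" of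
`robin_iff`), unconditionally: `RobinCriterion.robinInequality_imp_riemannHypothesis` fed with
`Robin1984_sigma_oscillation_holds`. [cite: Robin1984, §4 Prop. 1 and Thm. 1] -/
theorem riemannHypothesis_of_robinInequality (hR : ∀ n : ℕ, 5040 < n → robinInequality n) :
    RiemannHypothesis :=
  robinInequality_imp_riemannHypothesis Robin1984_sigma_oscillation_holds hR

/-- Robin's criterion `robin_iff` now rests on the single named fact `Robin1984_thm1`
(RH ⇒ Robin's inequality for `n > 5040`). [cite: Robin1984, Thm. 1] -/
theorem robin_iff_of_Robin1984_thm1 (h₁ : Robin1984_thm1) : robin_iff :=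
  robin_iff_of_robin1984 h₁ Robin1984_sigma_oscillation_holds

/-- Lagarias's criterion `lagarias_iff` now rests on the single named fact `Robin1984_sigma_le`
(= Lagarias's Prop. 3.1 = Robin's Thm. 1). [cite: Lagarias2002, Thm. 1.1] -/
theorem lagarias_iff_of_Robin1984_sigma_le (h₁ : Robin1984_sigma_le) : lagarias_iff :=
  lagarias_iff_of_robin' h₁ Robin1984_sigma_oscillation_holds

/-- **Lagarias's inequality for all `n ≥ 1` implies RH** (the direction "⇐" of Lagarias 2002,
Thm. 1.1), unconditionally: if `σ(n) ≤ H_n + exp(H_n) log(H_n)` for all `n ≥ 1` but RH fails,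
`Robin1984_sigma_oscillation_holds` gives infinitely many `n` with
`C n log log n/(log n)^β ≤ 7 n/log n` (Lemma 3.2), impossible. The argument is the second half of
`lagarias_iff_of_robin`. [cite: Lagarias2002, Thm. 1.1 (proof, §3)] -/
theorem riemannHypothesis_of_lagariasInequality
    (hE : ∀ n : ℕ, 1 ≤ n → (ArithmeticFunction.sigma 1 n : ℝ) ≤
      (harmonic n : ℝ) + Real.exp (harmonic n) * Real.log (harmonic n)) :
    RiemannHypothesis := by
  by_contra hRH
  obtain ⟨β, C, hβ0, hβ, hC, hfreq⟩ := Robin1984_sigma_oscillation_holds hRH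
  have hev : ∀ᶠ n : ℕ in atTop, 3 ≤ n ∧ 7 / C < Real.log (Real.log n) := by
    refine (eventually_ge_atTop 3).and ?_
    have ht : Tendsto (fun n : ℕ ↦ Real.log (Real.log n)) atTop atTop :=
      Real.tendsto_log_atTop.comp (Real.tendsto_log_atTop.comp tendsto_natCast_atTop_atTop)
    exact ht.eventually (eventually_gt_atTop (7 / C))
  obtain ⟨n, hσ, hn3, hLL⟩ := (hfreq.and_eventually hev).exists
  set G : ℝ := Real.exp Real.eulerMascheroniConstant with hGdef
  set L : ℝ := Real.log n with hLdef
  have hn0 : (0 : ℝ) < n := by exact_mod_cast (show 0 < n by omega)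
  have hL1 : 1 < L := one_lt_log_natCast hn3
  have hL0 : 0 < L := by linarith
  have hLL0 : 0 < Real.log L := Real.log_pos hL1
  have hup : (ArithmeticFunction.sigma 1 n : ℝ) ≤ G * n * Real.log L + 7 * n / L :=
    (hE n (by omega)).trans (Lagarias2002_lemma_3_2 (by omega))
  have h1 : C * n * Real.log L / L ^ β ≤ 7 * n / L := by linarith
  have hLβ : L ^ β ≤ L := by
    calc L ^ β ≤ L ^ (1 : ℝ) := Real.rpow_le_rpow_of_exponent_le hL1.le (by linarith)
      _ = L := Real.rpow_one L
  have hLβpos : 0 < L ^ β := Real.rpow_pos_of_pos hL0 β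
  have h2 : C * n * Real.log L / L ≤ C * n * Real.log L / L ^ β :=
    div_le_div_of_nonneg_left (by positivity) hLβpos hLβ
  have h3 : 7 * n / L < C * n * Real.log L / L := by
    rw [div_lt_div_iff_of_pos_right hL0]
    have h4 : 7 < C * Real.log L := by
      have := (div_lt_iff₀ hC).1 hLL
      linarith [this]
    nlinarith
  linarith

/-! ### Nicolas's own formulation: `log f(x) = Ω₋(x^{-b})` -/

/-- **Nicolas 1983, Thm. 3 (c) — the `Ω₋` half, in Nicolas's own terms.** If the Riemann
hypothesis is false there is `b ∈ (0, 1/2)` such that, for every real `c`,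
`log f(x) ≤ -c x^{-b}` for arbitrarily large `x`, where
`f(x) = e^γ log θ(x) ∏_{p ≤ x} (1 - 1/p)` (`nicolasF`, `NicolasMertensRH.lean`). This is the
first conjunct of the named fact `Nicolas1983_logf_omega` (there with some `c > 0`; the version
for every `c` is what Nicolas's Prop. 3 of §4, `lim inf x^{b'} log f(x) < 0` for all
`1 - θ < b' < 1/2`, gives when applied with some `b' < b`).
From `exists_nicolasFn_neg` and `log f(x) = γ + log log θ(x) - A(x) ≤ g(x) - c x^{-b}`
(`θ ≤ ψ` and `log_log_psi_le`). [cite: Nicolas1983, Thm. 3 (c) and §4 Prop. 3] -/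
theorem Nicolas1983_logf_omegaMinus (hRH : ¬ RiemannHypothesis) :
    ∃ b : ℝ, 0 < b ∧ b < 1 / 2 ∧
      ∀ c : ℝ, ∃ᶠ x : ℝ in atTop, Real.log (nicolasF x) ≤ -c * x ^ (-b) := by
  obtain ⟨b, hb0, hb, hneg⟩ := exists_nicolasFn_neg hRH
  refine ⟨b, hb0, hb, fun c ↦ ?_⟩
  rw [Filter.frequently_atTop]
  intro X
  obtain ⟨x, hxX, hgx⟩ := hneg c (max X 7)
  have hx7 : 7 ≤ x := le_trans (le_max_right _ _) hxX.le
  refine ⟨x, le_trans (le_max_left _ _) hxX.le, ?_⟩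
  have hθ1 : 1 < Chebyshev.theta x := one_lt_theta (by linarith)
  have hlogθ : 0 < Real.log (Chebyshev.theta x) := Real.log_pos hθ1
  have hprod : ∏ p ∈ Nat.primesLE ⌊x⌋₊, (1 - (p : ℝ)⁻¹) = Real.exp (-mertensLog x) := by
    rw [Real.exp_neg, mertensLog_eq_natCast_floor, exp_mertensLog_natCast,
      ← Finset.prod_inv_distrib]
    simp only [inv_inv]
  have hf : Real.log (nicolasF x) =
      Real.eulerMascheroniConstant + Real.log (Real.log (Chebyshev.theta x)) - mertensLog x := by
    rw [nicolasF, hprod, Real.log_mul (mul_pos (Real.exp_pos _) hlogθ).ne' (Real.exp_pos _).ne',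
      Real.log_mul (Real.exp_pos _).ne' hlogθ.ne', Real.log_exp, Real.log_exp]
    ring
  have hθψ : Real.log (Real.log (Chebyshev.theta x)) ≤ Real.log (Real.log (Chebyshev.psi x)) :=
    Real.log_le_log hlogθ (Real.log_le_log (by linarith) (Chebyshev.theta_le_psi x))
  have hψ := log_log_psi_le hx7
  have hg : nicolasFn b c x = c * x ^ (-b) + Real.eulerMascheroniConstant + Real.log (Real.log x)
      + psiError x - mertensLog x := rfl
  rw [hf]
  linarith

end RH

end Literature.NumberTheory.LFunctions

end
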